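import Mathlib.Topology.Instances.ZMod
import Literature.AnabelianGeometry.AbsoluteAnabelian.MLFGaloisGroupsHolds
import Literature.AnabelianGeometry.AbsoluteAnabelian.AbsAnabCoinvariantRankProofs
import HarnessLib

/-!
# [AbsTopI] Thm 2.6 (ii) AS TYPED for a general prime set `Σ`: the clause "`δ¹_l(Π) = δ¹_l(G)` if `l ∉ Σ`"

S. Mochizuki, *Topics in Absolute Anabelian Geometry I: Generalities* (2012) [AbsTopI], Thm 2.6
(ii), manuscript p. 21 (lit key `paper:url-11ac98ba15fc`): for `k` an MLF of residue characteristic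
`p` and construction data prime set `Σ`, "the quantity `δ¹_l(Π) − δ¹_l(G)` is `= 0` if `l ∉ Σ`, and
is independent of `l` if `l ∈ Σ`"; proof p. 23 ll. 17–20: "`δ¹_l(Π) = δ¹_l(G) + dim_{ℚ_l}(Q_l ⊗ ℚ_l)`
[where we recall that `dim_{ℚ_l}(Q_l ⊗ ℚ_l)` is independent of `l`] for `l ∈ Σ`, `δ¹_l(Π) = δ¹_l(G)`
for `l ∉ Σ`" — the latter because `Δ` is a pro-`Σ` group (p. 22 l. 40: "for `l ∈ Σ`, the quotient
of `Δ` determined by the image of `Δ` in the pro-`l` completion of `Π^{ab-t}` …"; for `l ∉ Σ` that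
image is trivial).

Proof-only companion (no definitions, no named facts) of abc-iut-L4-t4's statement file
`AbsTopISemiAbsolute.lean` (predicate `FundamentalExtension.Thm26ii B S`).  abc-iut-L4-t11's
`thm26ii_of_clauses` (`MLFGaloisGroupsHolds.lean`) reduces `E.Thm26ii B S` — unconditionally in its
`G`-clauses and in "`ε¹_p(Π) = ∞`" (abc-iut-L4-t4's rank formula `thm26_ii_delta_gal_holds`) — to
three `Π`-clauses; the sibling file `AbsTopIThm26iiStarProofs.lean` (abc-iut-L4-t4) settles them for
`Σ ⊇ Primes`, where the clause "`= 0` if `l ∉ Σ`" is vacuous.  HERE that clause is PROVED for an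
arbitrary `Σ` from the printed input "`Δ` is pro-`Σ`" (`IsProSet E.geom S`, [AbsTopI] Def 1.1
(iii)), for EVERY abstract extension `1 → Δ → Π → G → 1` of profinite groups:

* `IsProSet.apply_padicIntPi_eq_one` — a continuous homomorphism from a pro-`Σ` group to `ℤ_lⁿ`
  with `l ∉ Σ` is trivial (its reductions modulo `lᵏ` have open normal kernels of `l`-power index,
  hence of index `1`);
* `FundamentalExtension.freeProlRank_arith_eq_gal_of_isProSet` — hence every continuous
  `Π ↠ ℤ_lⁿ` kills `Δ` and factors continuously through `G` (abc-iut-L4-d3's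
  `exists_continuousMonoidHom_factor`), so `δ¹_l(Π) = δ¹_l(G)` for `l ∉ Σ`;
* `FundamentalExtension.thm26ii_of_isProSet_of_rank` — `E.Thm26ii B S` for ANY `S`, GIVEN `Π`
  topologically finitely generated, `Δ` pro-`S`, and the printed rank identity
  "`δ¹_l(Π) = δ¹_l(G) + m` for `l ∈ Σ`" with one `m` (hypothesis in existing vocabulary);
* `FundamentalExtension.thm26ii_of_starCondition_of_isProSet` — the same with the rank identity
  supplied, as in the sibling file, by a splitting over an open subgroup of `G`
  (`E.SplitsOverOpenSubgroup`) and condition (∗) of [AbsAnab] Lemma 1.1.4 (ii) (`E.StarCondition`)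
  via abc-iut-L4-d3's `exists_freeProlRank_open_eq_add`, and "`Π` tfg" from `Δ` tfg ([AbsTopI]
  Prop 2.2, `E.GeomTFG`) and `G` tfg ("[NSW], Theorem 7.5.10"; hypothesis, GAP-LEDGER G-L4t4-2).
  HONEST SCOPE: (∗) is printed in [AbsAnab] for the full profinite `π₁` (`Σ = Primes`); for a
  pro-`Σ` `Δ` with `Σ ≠ Primes` it forces `m = 0` (the `Ẑ^m`-quotient of (∗) is pro-`Σ` only if
  `m = 0`), so in that range the last theorem covers exactly the case `Q = 0` of print's `Q_l`.

HONEST FRAMING: [AbsTopI] is a refereed, undisputed paper; classical profinite group theory; nothing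
here bears on [IUTchIII] Cor. 3.12; typed ≠ proved elsewhere; the inputs stay explicit hypotheses.
-/

noncomputable section

open Topology

namespace Literature.AnabelianGeometry.AbsoluteAnabelian

universe u

/-! ### A pro-`Σ` group has no nontrivial continuous homomorphism to `ℤ_lⁿ`, `l ∉ Σ` -/

section ProSigma

variable {D : Type u} [Group D] [TopologicalSpace D]

/-- Reduction modulo `lᵏ`, `ℤ_l → ℤ/lᵏ`, is continuous (its fibres are closed balls of radius
`l^{-k}`, which are open). [folklore] -/
private theorem continuous_toZModPow (l : ℕ) [Fact l.Prime] (k : ℕ) :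
    Continuous (PadicInt.toZModPow k : ℤ_[l] → ZMod (l ^ k)) := by
  refine ((IsLocallyConstant.iff_isOpen_fiber).mpr fun c => ?_).continuous
  rw [isOpen_iff_mem_nhds]
  intro x hx
  have hx' : PadicInt.toZModPow k x = c := hx
  have hpos : (0 : ℝ) < (l : ℝ) ^ (-(k : ℤ)) :=
    zpow_pos (by exact_mod_cast (Fact.out : l.Prime).pos) _
  refine Filter.mem_of_superset (Metric.ball_mem_nhds x hpos) fun y hy => ?_
  change PadicInt.toZModPow k y ∈ ({c} : Set (ZMod (l ^ k)))
  rw [Set.mem_singleton_iff, ← hx', ← sub_eq_zero, ← map_sub, ← RingHom.mem_ker,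
    PadicInt.ker_toZModPow, ← PadicInt.norm_le_pow_iff_mem_span_pow, ← dist_eq_norm]
  exact (Metric.mem_ball.mp hy).le

/-- **A continuous homomorphism from a pro-`Σ` group to `ℤ_lⁿ` is trivial when `l ∉ Σ`.**  For each
`k`, the composite `D → ℤ_lⁿ → (ℤ/lᵏ)ⁿ` has an open normal kernel whose index divides `l^{kn}`; a
prime dividing that index lies in `Σ` (pro-`Σ`) and equals `l ∉ Σ`, so the index is `1`, i.e. every
coordinate of `ψ(x)` vanishes modulo every `lᵏ`.  This is the content of "`δ¹_l(Π) = δ¹_l(G)` for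
`l ∉ Σ`" (proof of Thm 2.6 (ii), p. 23): the image of the pro-`Σ` group `Δ` in any pro-`l` quotient of
`Π` is trivial. [cite: MochizukiAbsTopI2012, Thm 2.6 (ii) p.21] -/
theorem IsProSet.apply_padicIntPi_eq_one {S : Set ℕ} (hD : IsProSet D S) {l : ℕ} [hl : Fact l.Prime]
    (hlS : l ∉ S) {n : ℕ} (ψ : D →ₜ* Multiplicative (Fin n → ℤ_[l])) (x : D) : ψ x = 1 := by
  classical
  apply Multiplicative.toAdd.injective
  funext i
  change Multiplicative.toAdd (ψ x) i = 0
  refine (PadicInt.ext_of_toZModPow).mp fun k => ?_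
  rw [map_zero]
  -- reduction modulo `lᵏ` on every coordinate
  let red : Multiplicative (Fin n → ℤ_[l]) →* Multiplicative (Fin n → ZMod (l ^ k)) :=
    AddMonoidHom.toMultiplicative
      (((PadicInt.toZModPow k : ℤ_[l] →+* ZMod (l ^ k)).toAddMonoidHom).compLeft (Fin n))
  have hred : Continuous red :=
    continuous_ofAdd.comp ((continuous_pi fun j =>
      (continuous_toZModPow l k).comp ((continuous_apply j).comp continuous_toAdd)))
  let φ : D →* Multiplicative (Fin n → ZMod (l ^ k)) := red.comp ψ.toMonoidHom
  have hφ : Continuous φ := hred.comp ψ.continuous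
  -- its kernel: open, normal, of index dividing `l^{kn}`
  have hUo : IsOpen (φ.ker : Set D) :=
    (isOpen_discrete {(1 : Multiplicative (Fin n → ZMod (l ^ k)))}).preimage hφ
  haveI : NeZero (l ^ k) := ⟨pow_ne_zero _ hl.out.ne_zero⟩
  have hdvd : φ.ker.index ∣ (l ^ k) ^ n := by
    rw [Subgroup.index_ker]
    have h1 := Subgroup.card_subgroup_dvd_card φ.range
    have hn : Nat.card (Fin n) = n := by simp
    rwa [Nat.card_congr Multiplicative.toAdd, Nat.card_fun, Nat.card_zmod, hn] at h1
  -- hence of index `1`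
  have hidx : φ.ker.index = 1 := by
    by_contra h
    obtain ⟨q, hq, hqd⟩ := Nat.exists_prime_and_dvd h
    have hqS : q ∈ S := hD.prime_dvd_index φ.ker inferInstance hUo q hq hqd
    have hql : q = l :=
      (Nat.prime_dvd_prime_iff_eq hq hl.out).mp (hq.dvd_of_dvd_pow (hq.dvd_of_dvd_pow (hqd.trans hdvd)))
    exact hlS (hql ▸ hqS)
  have hx1 : φ x = 1 := by
    have hx : x ∈ φ.ker := by
      rw [Subgroup.index_eq_one.mp hidx]
      exact Subgroup.mem_top x
    exact hx
  have := congrFun (congrArg Multiplicative.toAdd hx1) i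
  exact this

end ProSigma

namespace FundamentalExtension

variable (E : FundamentalExtension.{u})

/-! ### "`δ¹_l(Π) = δ¹_l(G)` for `l ∉ Σ`" -/

/-- **[AbsTopI] Thm 2.6 (ii), the clause "`δ¹_l(Π) − δ¹_l(G) = 0` if `l ∉ Σ`"**, for EVERY extension
`1 → Δ → Π → G → 1` of profinite groups with `Δ` pro-`Σ` (`IsProSet E.geom S`): if `l ∉ Σ` then
`δ¹_l(Π) = δ¹_l(G)` — every continuous surjection `Π ↠ ℤ_lⁿ` kills the pro-`Σ` group `Δ`
(`IsProSet.apply_padicIntPi_eq_one`), hence factors continuously through `Π ↠ G` (a quotient map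
of compact Hausdorff groups), and conversely `δ¹_l(G) ≤ δ¹_l(Π)` along `Π ↠ G`.  Print, proof
p. 23: "`δ¹_l(Π) = δ¹_l(G)` for `l ∉ Σ`". [cite: MochizukiAbsTopI2012, Thm 2.6 (ii) p.21] -/
theorem freeProlRank_arith_eq_gal_of_isProSet {S : Set ℕ} (hΔ : IsProSet E.geom S) (l : ℕ)
    [Fact l.Prime] (hlS : l ∉ S) : freeProlRank E.arith l = freeProlRank E.gal l := by
  refine le_antisymm ?_ (freeProlRank_le_of_surjective E.aug E.aug_surjective l)
  unfold freeProlRank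
  refine iSup₂_le fun n hn => ?_
  obtain ⟨f, hf⟩ := hn
  -- `f` kills `Δ`
  have hker : ∀ a, E.aug a = 1 → f a = 1 := by
    intro a ha
    let ψ : E.geom →ₜ* Multiplicative (Fin n → ℤ_[l]) :=
      ⟨f.toMonoidHom.comp E.geom.subtype, f.continuous.comp continuous_subtype_val⟩
    exact hΔ.apply_padicIntPi_eq_one hlS ψ ⟨a, (E.mem_geom).mpr ha⟩
  -- so it factors continuously through `G`
  obtain ⟨χ, hχ⟩ := exists_continuousMonoidHom_factor E.aug E.aug_surjective f hker
  have hχs : Function.Surjective χ := fun y => by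
    obtain ⟨a, ha⟩ := hf y
    exact ⟨E.aug a, by rw [hχ, ha]⟩
  exact le_iSup₂_of_le n ⟨χ, hχs⟩ le_rfl

/-! ### Assembly for a general `Σ` -/

/-- `δ¹_l(G) < ∞` for every prime `l`, for an extension with MLF base data `G ≅ G_k`: "`δ¹_l(G) = 1`
(`l ≠ p`), `δ¹_p(G) = [k : ℚ_p] + 1`" is a theorem of the tree (abc-iut-L4-t11's `freeProlRank_gal`
over abc-iut-L4-t4's `thm26_ii_delta_gal_holds`). [cite: MochizukiAbsTopI2012, Thm 2.6 (ii) p.21] -/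
private theorem freeProlRank_gal_ne_top' {E : FundamentalExtension.{0}} (B : E.MLFBase) (l : ℕ)
    [Fact l.Prime] : freeProlRank E.gal l ≠ ⊤ := by
  by_cases hl : l = B.p
  · subst hl
    rw [(freeProlRank_gal B).2]
    exact ENat.coe_ne_top _
  · rw [(freeProlRank_gal B).1 l hl]
    exact ENat.one_ne_top

/-- **[AbsTopI] Thm 2.6 (ii) AS TYPED, for an ARBITRARY prime set `Σ`**, the printed deduction
kernel-checked for EVERY extension `1 → Δ → Π → G → 1` with MLF base data `G ≅ G_k`: GIVEN
(a) "`Π` is topologically finitely generated" (in print: from `Δ` tfg [Prop 2.2] and `G` tfg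
    [[NSW] 7.5.10]),
(b) `Δ` pro-`Σ` (`IsProSet E.geom S`, [AbsTopI] Def 1.1 (iii)), and
(c) the printed rank identity "`δ¹_l(Π) = δ¹_l(G) + dim_{ℚ_l}(Q_l ⊗ ℚ_l)` [independent of `l`] for
    `l ∈ Σ`" — one `m : ℕ` with `δ¹_l(Π) = δ¹_l(G) + m` for all primes `l ∈ Σ` —,
the predicate `E.Thm26ii B S` holds: the `G`-clauses and "`ε¹_p(Π) = ∞`" are theorems
(`thm26ii_of_clauses`), the clause "`= 0` if `l ∉ Σ`" is `freeProlRank_arith_eq_gal_of_isProSet`,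
and the clause "independent of `l` if `l ∈ Σ`" is (c) with the finiteness of the `δ¹_l(G)`.
[cite: MochizukiAbsTopI2012, Thm 2.6 (ii) p.21] -/
theorem thm26ii_of_isProSet_of_rank {E : FundamentalExtension.{0}} (B : E.MLFBase) (S : Set ℕ)
    (htfg : IsTopologicallyFinitelyGenerated E.arith) (hpro : IsProSet E.geom S)
    (hQ : ∃ m : ℕ, ∀ (l : ℕ) [Fact l.Prime], l ∈ S →
      freeProlRank E.arith l = freeProlRank E.gal l + m) :
    E.Thm26ii B S := by
  refine thm26ii_of_clauses B S htfg ?_ ?_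
  · intro l _ hlS
    exact E.freeProlRank_arith_eq_gal_of_isProSet hpro l hlS
  · intro l₁ l₂ _ _ h₁ h₂
    obtain ⟨m, hm⟩ := hQ
    rw [hm l₁ h₁, hm l₂ h₂,
      (ENat.addLECancellable_of_ne_top (freeProlRank_gal_ne_top' B l₁)).add_tsub_cancel_left,
      (ENat.addLECancellable_of_ne_top (freeProlRank_gal_ne_top' B l₂)).add_tsub_cancel_left]

/-- A subgroup equal to `⊤` is bicontinuously isomorphic to the ambient group. [folklore] -/
private theorem nonempty_continuousMulEquiv_of_eq_top' {G : Type u} [Group G] [TopologicalSpace G]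
    (K : Subgroup G) (h : K = ⊤) : Nonempty (K ≃ₜ* G) :=
  ⟨{ toFun := fun x => (x : G)
     invFun := fun g => ⟨g, h ▸ Subgroup.mem_top g⟩
     left_inv := fun _ => rfl
     right_inv := fun _ => rfl
     map_mul' := fun _ _ => rfl
     continuous_toFun := continuous_subtype_val
     continuous_invFun := Continuous.subtype_mk continuous_id _ }⟩

/-- "`δ¹_l(Π) = δ¹_l(G) + dim_{ℚ_l}(Q_l ⊗ ℚ_l)`, independent of `l`" (proof of Thm 2.6 (ii), p. 23) in
the form supplied by a splitting over an open subgroup of `G` and (∗): ONE `m : ℕ` with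
`δ¹_l(Π) = δ¹_l(G) + m` for every prime `l` — abc-iut-L4-d3's `exists_freeProlRank_open_eq_add` at
`Π′ = Π`, transported along `⊤ ≅ Π`, `aug(⊤) = ⊤ ≅ G` (the same transport as the sibling file's
`exists_freeProlRank_arith_eq_gal_add`, kept private here). [cite: MochizukiAbsTopI2012, Thm 2.6 (ii) p.21] -/
private theorem exists_freeProlRank_arith_eq_gal_add' (hs : E.SplitsOverOpenSubgroup)
    (hstar : E.StarCondition) :
    ∃ m : ℕ, ∀ (l : ℕ) [Fact l.Prime], freeProlRank E.arith l = freeProlRank E.gal l + m := by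
  obtain ⟨m, hm⟩ := E.exists_freeProlRank_open_eq_add hs hstar ⊤
    (by rw [Subgroup.coe_top]; exact isOpen_univ)
  refine ⟨m, fun l _ => ?_⟩
  obtain ⟨e₁⟩ := nonempty_continuousMulEquiv_of_eq_top' (⊤ : Subgroup E.arith) rfl
  obtain ⟨e₂⟩ := nonempty_continuousMulEquiv_of_eq_top'
    ((⊤ : Subgroup E.arith).map E.aug.toMonoidHom) (Subgroup.map_top_of_surjective _ E.aug_surjective)
  rw [← freeProlRank_eq_of_continuousMulEquiv e₁ l, hm l, freeProlRank_eq_of_continuousMulEquiv e₂ l]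

/-- **[AbsTopI] Thm 2.6 (ii) AS TYPED, general `Σ`, from the inputs by name**: for EVERY extension
`1 → Δ → Π → G → 1` with MLF base data `G ≅ G_k`, GIVEN
(a) `Δ` topologically finitely generated ([AbsTopI] Prop 2.2, `E.GeomTFG`),
(b) `G` topologically finitely generated ("[NSW], Theorem 7.5.10"; hypothesis, GAP-LEDGER G-L4t4-2),
(c) `Δ` pro-`Σ` (`IsProSet E.geom S`),
(d) a splitting over an open subgroup of `G` ("the existence of a rational point of `A` over some
    finite extension of `k`", `E.SplitsOverOpenSubgroup`) and
(e) condition (∗) of [AbsAnab] Lemma 1.1.4 (ii) (`E.StarCondition`),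
the predicate `E.Thm26ii B S` holds.  HONEST SCOPE: for `Σ ≠ Primes`, (c) + (e) force the `Ẑ`-rank
`m` of (∗) to be `0` (see the module docstring); the case `Σ ⊇ Primes` is the sibling theorem
`thm26ii_of_starCondition`. [cite: MochizukiAbsTopI2012, Thm 2.6 (ii) p.21] -/
theorem thm26ii_of_starCondition_of_isProSet {E : FundamentalExtension.{0}} (B : E.MLFBase)
    (S : Set ℕ) (hΔ : E.GeomTFG) (hG : IsTopologicallyFinitelyGenerated E.gal)
    (hpro : IsProSet E.geom S) (hs : E.SplitsOverOpenSubgroup) (hstar : E.StarCondition) :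
    E.Thm26ii B S := by
  refine thm26ii_of_isProSet_of_rank B S
    (IsTopologicallyFinitelyGenerated.of_extension E.aug E.aug_surjective hΔ hG) hpro ?_
  obtain ⟨m, hm⟩ := E.exists_freeProlRank_arith_eq_gal_add' hs hstar
  exact ⟨m, fun l _ _ => hm l⟩

end FundamentalExtension

end Literature.AnabelianGeometry.AbsoluteAnabelian
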